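import Mathlib.Analysis.Normed.Ring.Ultra
import Mathlib.Analysis.Normed.Field.Basic
import Mathlib.NumberTheory.Padics.PadicVal.Basic
import Mathlib.NumberTheory.Multiplicity
import Mathlib.Algebra.Ring.GeomSum
import Mathlib.Algebra.BigOperators.Fin
import Mathlib.Tactic.LinearCombination
import Mathlib.Tactic.FieldSimp
import Mathlib.Tactic.Linarith
import Mathlib.Tactic.Positivity
import Mathlib.Tactic.GCongr
import Summits.BirchSwinnertonDyer.Rank1Residual.P2.PrintCf2SplitBadTwoShiftLift
import HarnessLib

set_option autoImplicit false

/-!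
# The `2`-adic SMOOTHING DIGIT `v₂(χ(σ_𝔞)⁻¹ − N𝔞)`: `2`-power roots of unity and odd integers are `≡ 1 (mod 𝔪)` when `‖2‖ < 1`
# (so the smoothing factor is never a unit on `2`-power-order values, and is a unit on odd-order values `≠ 1`),
# the twelfth-root linearity of a Galois-weighted log column, and the per-key norm assembly of `12·s·I = G⁻¹·U`

Cell `bsd-print-cf2`, typer `bsd-print-cf2-ty2` g45 (literature-prover seat; typer directory `Rank1Residual/P2/`, Theses-free, no
item): port P60 (part 2 of 2; scrit g44 rev 3, STUB-PLAN v7.8 row 127 = R224 «(b″)-LOCAL LEDGER CLOSED + THE LOCAL CEILING») of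
STUB-PLAN `stub_heegnerIndexLowerAtTwo` (crux `PrintCf2.SplitBadTwoLowerHalfOfFacts`, stmt-BirchSwinnertonDyer-27851; sketch k2-g43
`95047f8cd23e63a8` §2 T2, §3 T3, §4 VERBATIM; its two `Prop`-shapes `TwelfthPowerShape` / `SmoothingChoiceShape` are DROPPED per scrit;
T1 = `Literature.NumberTheory.EllipticCurves.norm_column_invAmice₁_le` & co., PAdicOneVariableGaussSum §4).  Generic ultrametric
algebra (filed Summits-side because these are folklore lemmas without a printed locator; `2`-power roots of unity are principal units =
the tree's `LubinTate.norm_sub_one_lt_one_of_pow_two_pow_eq_one`, odd naturals are units = `ShiftLift.norm_natCast_eq_one_of_odd`).  HONEST FRAMING: nothing here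
proves BSD, the crux or the stub; no definition, no named fact, no `sorry`.

* §1 T2 twelfth-root linearity: `sum_mul_log_act_pow`, `norm_sum_mul_log_act_pow` (de Shalit II.2.7: the Θ-units are 12-th powers).
* §2 T3 the smoothing digit at `p = 2`: `norm_natCast_sub_one_lt_one`,
  ★ `norm_rootTwoPow_sub_odd_lt_one` (`s ≥ 1` on `2`-power-order values),
  ★ `norm_sub_one_eq_one_of_pow_eq_one_odd`, ★ `norm_rootOdd_sub_odd_eq_one` (`s = 0` on odd-order values `≠ 1`), and the `±1` digits
  `padicValNat_two_sub_one_of_mod_four_eq_three` / `padicValNat_two_add_one_of_mod_four_eq_one` / `two_le_padicValNat_two_…`.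
* §3 per-key assembly: `norm_integral_eq_of_identity`, ★ `norm_integral_le_of_factor_bounds` (`‖I‖ ≤ γ·β/σ`).
* §4 (typer g46, port P61 (c): sketch k1-g42 `a2cbc91c41538373` §6, STUB-PLAN v7.9 row 128 = R225-EQ) the LEDGER digit (LTE at `2`):
  `emultiplicity_two_geom_sum` (`v₂(Σ_{x<2^m} u^x) = m` for `u ≡ 1 (4)`, `u ≠ 1`) and its two-direction form
  `emultiplicity_two_geom_sum_prod` — passing from coset VALUES of a truncated character to level MASSES costs `|G_N|⁻¹`,
  repaid with zero slack (Mathlib's lifting-the-exponent `Int.two_pow_two_pow_sub_pow_two_pow`).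

References: [deShalit1987] II.2.7 (p. 48), II.4.12–4.14 (p. 67–73), II.5.2 (3); [Washington1997] §4 (Gauss sums).
-/

namespace Summit.BirchSwinnertonDyer.Rank1Residual.P2.SmoothingDigit

open Finset

/-! ### §1. T2 — twelfth-root linearity (de Shalit II.2.7, Gillard–Robert) -/

section TwelfthRoot

/-- **T2a.** A Galois-weighted log column is linear in the unit: `Σ_g c(g)·ℓ(g·u^m) = m · Σ_g c(g)·ℓ(g·u)`
for any `ℓ` with `ℓ(x^m) = m·ℓ(x)` and any action by monoid homs (the shape of `unitLogSum`). -/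
theorem sum_mul_log_act_pow {G M A : Type*} [Fintype G] [Monoid M] [CommRing A]
    (c : G → A) (ℓ : M → A) (act : G → M →* M) (hℓ : ∀ (x : M) (m : ℕ), ℓ (x ^ m) = (m : A) * ℓ x)
    (u : M) (m : ℕ) :
    ∑ g, c g * ℓ (act g (u ^ m)) = (m : A) * ∑ g, c g * ℓ (act g u) := by
  simp_rw [map_pow, hℓ, Finset.mul_sum]
  exact Finset.sum_congr rfl fun g _ ↦ by ring

/-- **T2b.** Hence `‖column(u^m)‖ = ‖m‖ · ‖column(u)‖`: for `m = 12` at `p = 2` the column of the Θ-unit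
`u = φ^{12}` (II.2.7: `Θ(v; L, 𝔞)` is a `12 w_𝔣`-th power in `K(𝔣)^×`, `(𝔞, 6𝔣) = 1`; `w_𝔣 = 1` on the frame)
is `‖12‖₂ = ¼` times the column of `φ` — exactly the `‖12‖⁻¹` of identity (4). -/
theorem norm_sum_mul_log_act_pow {G M A : Type*} [Fintype G] [Monoid M] [NormedField A]
    (c : G → A) (ℓ : M → A) (act : G → M →* M) (hℓ : ∀ (x : M) (m : ℕ), ℓ (x ^ m) = (m : A) * ℓ x)
    (u : M) (m : ℕ) :
    ‖∑ g, c g * ℓ (act g (u ^ m))‖ = ‖(m : A)‖ * ‖∑ g, c g * ℓ (act g u)‖ := by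
  rw [sum_mul_log_act_pow c ℓ act hℓ u m, norm_mul]


end TwelfthRoot

/-! ### §2. T3 — the smoothing digit `v₂(χ(σ_𝔞)⁻¹ − N𝔞)` at `p = 2` -/

section Smoothing

variable {𝕜 : Type*} [NormedField 𝕜] [IsUltrametricDist 𝕜]

/-- Ultrametric inequality for differences. -/
private theorem norm_sub_le_max' (x y : 𝕜) : ‖x - y‖ ≤ max ‖x‖ ‖y‖ := by
  rw [sub_eq_add_neg, ← norm_neg y]
  exact IsUltrametricDist.norm_add_le_max x (-y)

/-- Isosceles triangles, difference form. -/
private theorem norm_sub_eq_max_of_norm_ne_norm' {x y : 𝕜} (h : ‖x‖ ≠ ‖y‖) : ‖x - y‖ = max ‖x‖ ‖y‖ := by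
  have h' : ‖x‖ ≠ ‖-y‖ := by rwa [norm_neg]
  rw [sub_eq_add_neg, IsUltrametricDist.norm_add_eq_max_of_norm_ne_norm h', norm_neg]

/-- Odd naturals are `≡ 1` to first order: `‖(m : 𝕜) − 1‖ < 1` for odd `m` when `‖2‖ < 1`. -/
theorem norm_natCast_sub_one_lt_one (h2 : ‖(2 : 𝕜)‖ < 1) {m : ℕ} (hm : Odd m) :
    ‖(m : 𝕜) - 1‖ < 1 := by
  obtain ⟨j, rfl⟩ := hm
  have : ((2 * j + 1 : ℕ) : 𝕜) - 1 = 2 * (j : 𝕜) := by push_cast; ring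
  rw [this, norm_mul]
  calc ‖(2 : 𝕜)‖ * ‖(j : 𝕜)‖ ≤ ‖(2 : 𝕜)‖ * 1 :=
        mul_le_mul_of_nonneg_left (IsUltrametricDist.norm_natCast_le_one 𝕜 j) (norm_nonneg _)
    _ < 1 := by rw [mul_one]; exact h2

/-- **T3(i) — the smoothing factor is never a unit at `p = 2` for `2`-power-order values:**
`z^{2^k} = 1`, `m` odd ⇒ `‖z − m‖ < 1`.  (All `2`-power roots of unity and all odd `N𝔞` are `≡ 1 mod 𝔪`.) -/
theorem norm_rootTwoPow_sub_odd_lt_one (h2 : ‖(2 : 𝕜)‖ < 1) {k : ℕ} {z : 𝕜} (hz : z ^ 2 ^ k = 1)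
    {m : ℕ} (hm : Odd m) : ‖z - (m : 𝕜)‖ < 1 := by
  have h1 := Literature.NumberTheory.GaloisRepresentations.LubinTate.norm_sub_one_lt_one_of_pow_two_pow_eq_one h2 hz
  have h3 := norm_natCast_sub_one_lt_one h2 hm
  have : z - (m : 𝕜) = (z - 1) - ((m : 𝕜) - 1) := by ring
  rw [this]
  calc ‖(z - 1) - ((m : 𝕜) - 1)‖ ≤ max ‖z - 1‖ ‖(m : 𝕜) - 1‖ :=
        norm_sub_le_max' _ _
    _ < 1 := max_lt h1 h3

/-- `‖Σ_{i<k} z^i − k‖ ≤ ‖z − 1‖` for `‖z‖ ≤ 1` (each `z^i − 1 = (z − 1)·Σ_{j<i} z^j`). -/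
private theorem norm_geom_sum_sub_card_le {z : 𝕜} (hz : ‖z‖ ≤ 1) (k : ℕ) :
    ‖(∑ i ∈ range k, z ^ i) - (k : 𝕜)‖ ≤ ‖z - 1‖ := by
  have hrew : (∑ i ∈ range k, z ^ i) - (k : 𝕜) = ∑ i ∈ range k, (z ^ i - 1) := by
    rw [Finset.sum_sub_distrib]; simp
  rw [hrew]
  refine IsUltrametricDist.norm_sum_le_of_forall_le_of_nonneg (norm_nonneg _) fun i _ ↦ ?_
  have hgeom : z ^ i - 1 = (∑ j ∈ range i, z ^ j) * (z - 1) := (geom_sum_mul z i).symm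
  rw [hgeom, norm_mul]
  calc ‖∑ j ∈ range i, z ^ j‖ * ‖z - 1‖ ≤ 1 * ‖z - 1‖ := by
        refine mul_le_mul_of_nonneg_right ?_ (norm_nonneg _)
        refine IsUltrametricDist.norm_sum_le_of_forall_le_of_nonneg zero_le_one fun j _ ↦ ?_
        rw [norm_pow]; exact pow_le_one₀ (norm_nonneg _) hz
    _ = ‖z - 1‖ := one_mul _

/-- **T3(ii) — no loss for odd-order values:** `z^k = 1`, `k` odd, `z ≠ 1` ⇒ `‖z − 1‖ = 1` (when `‖2‖ < 1`). -/
theorem norm_sub_one_eq_one_of_pow_eq_one_odd (h2 : ‖(2 : 𝕜)‖ < 1) {k : ℕ} (hk : Odd k) {z : 𝕜}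
    (hz : z ^ k = 1) (hz1 : z ≠ 1) : ‖z - 1‖ = 1 := by
  have hk0 : 0 < k := hk.pos
  have hnz : ‖z‖ = 1 := by
    have h := congrArg norm hz
    rw [norm_pow, norm_one] at h
    exact (pow_eq_one_iff_of_nonneg (norm_nonneg z) hk0.ne').mp h
  have hle : ‖z - 1‖ ≤ 1 := by
    calc ‖z - 1‖ ≤ max ‖z‖ ‖(1 : 𝕜)‖ := norm_sub_le_max' _ _
      _ = 1 := by rw [hnz, norm_one, max_self]
  refine le_antisymm hle ?_
  by_contra hcon
  push Not at hcon
  -- the geometric sum vanishes since `z ≠ 1` and `z^k = 1`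
  have hgs : (∑ i ∈ range k, z ^ i) * (z - 1) = 0 := by rw [geom_sum_mul, hz, sub_self]
  have hsum0 : ∑ i ∈ range k, z ^ i = 0 := by
    rcases mul_eq_zero.mp hgs with h | h
    · exact h
    · exact absurd (sub_eq_zero.mp h) hz1
  -- but it is `≡ k`, a unit
  have hk1 : ‖(k : 𝕜)‖ = 1 := ShiftLift.norm_natCast_eq_one_of_odd h2 hk
  have hdiff := norm_geom_sum_sub_card_le hnz.le k
  rw [hsum0, zero_sub, norm_neg, hk1] at hdiff
  linarith

/-- **T3(ii′).** Hence for `z ≠ 1` of odd order and `m` odd: `‖z − m‖ = 1` — choosing `𝔞` with `χ(σ_𝔞)` of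
non-`2`-power order makes the smoothing factor a UNIT (`s = 0`). -/
theorem norm_rootOdd_sub_odd_eq_one (h2 : ‖(2 : 𝕜)‖ < 1) {k : ℕ} (hk : Odd k) {z : 𝕜} (hz : z ^ k = 1)
    (hz1 : z ≠ 1) {m : ℕ} (hm : Odd m) : ‖z - (m : 𝕜)‖ = 1 := by
  have h1 := norm_sub_one_eq_one_of_pow_eq_one_odd h2 hk hz hz1
  have h3 := norm_natCast_sub_one_lt_one h2 hm
  have hrew : z - (m : 𝕜) = (z - 1) - ((m : 𝕜) - 1) := by ring
  have hne : ‖z - 1‖ ≠ ‖(m : 𝕜) - 1‖ := by rw [h1]; exact (ne_of_lt h3).symm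
  rw [hrew, norm_sub_eq_max_of_norm_ne_norm' hne, h1]
  exact max_eq_left h3.le

/-- **T3(iii) — the `±1` digits in the consumer's `padicValNat 2` currency.** `m ≡ 3 (4) ⇒ v₂(m − 1) = 1`
(`χ(σ_𝔞) = +1`, `N𝔞 ≡ 3 mod 4`). -/
theorem padicValNat_two_sub_one_of_mod_four_eq_three {m : ℕ} (hm : m % 4 = 3) :
    padicValNat 2 (m - 1) = 1 := by
  have h : m - 1 = 2 * (2 * (m / 4) + 1) := by omega
  rw [h, padicValNat.mul (by norm_num) (by omega), padicValNat.self (by norm_num),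
    padicValNat.eq_zero_of_not_dvd (by omega)]

/-- `m ≡ 1 (4) ⇒ v₂(m + 1) = 1` (`χ(σ_𝔞) = −1`, `N𝔞 ≡ 1 mod 4`). -/
theorem padicValNat_two_add_one_of_mod_four_eq_one {m : ℕ} (hm : m % 4 = 1) :
    padicValNat 2 (m + 1) = 1 := by
  have h : m + 1 = 2 * (2 * (m / 4) + 1) := by omega
  rw [h, padicValNat.mul (by norm_num) (by omega), padicValNat.self (by norm_num),
    padicValNat.eq_zero_of_not_dvd (by omega)]

/-- … and the other residues cost at least two: `m ≡ 1 (4) ⇒ 2 ≤ v₂(m − 1)` (`m > 1`). -/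
theorem two_le_padicValNat_two_sub_one_of_mod_four_eq_one {m : ℕ} (hm : m % 4 = 1) (hm1 : 1 < m) :
    2 ≤ padicValNat 2 (m - 1) := by
  have h4 : 4 ∣ m - 1 := by omega
  have hne : m - 1 ≠ 0 := by omega
  have := (padicValNat_dvd_iff_le hne).mp (by simpa using h4 : 2 ^ 2 ∣ m - 1)
  exact this

/-- `m ≡ 3 (4) ⇒ 2 ≤ v₂(m + 1)`. -/
theorem two_le_padicValNat_two_add_one_of_mod_four_eq_three {m : ℕ} (hm : m % 4 = 3) :
    2 ≤ padicValNat 2 (m + 1) := by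
  have h4 : 4 ∣ m + 1 := by omega
  have := (padicValNat_dvd_iff_le (by omega : m + 1 ≠ 0)).mp (by simpa using h4 : 2 ^ 2 ∣ m + 1)
  exact this

end Smoothing

/-! ### §3. Per-key assembly: what the three factor bounds give for `∫ χ̂⁻¹ dμ` -/

section Assembly

variable {𝕜 : Type*} [NormedField 𝕜]

/-- **(4) read in norms.** From `twelve·s·I = Ginv·U` with `twelve·s ≠ 0`:
`‖I‖ = ‖Ginv‖·‖U‖/(‖twelve‖·‖s‖)`. -/
theorem norm_integral_eq_of_identity {twelve s I Ginv U : 𝕜} (h : twelve * s * I = Ginv * U)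
    (h12 : twelve ≠ 0) (hs : s ≠ 0) : ‖I‖ = ‖Ginv‖ * ‖U‖ / (‖twelve‖ * ‖s‖) := by
  have hts : twelve * s ≠ 0 := mul_ne_zero h12 hs
  have hI : I = Ginv * U / (twelve * s) := by
    field_simp
    linear_combination h
  rw [hI, norm_div, norm_mul, norm_mul]

/-- **Per-key LOWER bound from the three factors (B75 shape).** If `‖Ginv‖ ≤ γ` (Gauss digit, k1-g40:
`γ = 2^{n/2}`), `‖U‖ ≤ ‖twelve‖·β` (column: T1 + T2, `β = 2^{−n/2}` for the primitive-lattice unit) and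
`σ ≤ ‖s‖` (smoothing, T3: `σ = 2^{−s_min}`), then `‖I‖ ≤ γ·β/σ` — i.e. `v₂(∫χ̂⁻¹dμ) ≥ −s_min(χ)`:
the per-factor route reproduces integrality EXACTLY up to the smoothing digit, never beyond. -/
theorem norm_integral_le_of_factor_bounds {twelve s I Ginv U : 𝕜} (h : twelve * s * I = Ginv * U)
    (h12 : twelve ≠ 0) {γ β σ : ℝ} (hγ : ‖Ginv‖ ≤ γ) (hβ0 : 0 ≤ β) (hU : ‖U‖ ≤ ‖twelve‖ * β)
    (hσ : 0 < σ) (hsσ : σ ≤ ‖s‖) : ‖I‖ ≤ γ * β / σ := by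
  have hs : s ≠ 0 := by
    intro h0; rw [h0, norm_zero] at hsσ; exact absurd hsσ (not_le.mpr hσ)
  have h12pos : 0 < ‖twelve‖ := norm_pos_iff.mpr h12
  have hγ0 : 0 ≤ γ := (norm_nonneg _).trans hγ
  rw [norm_integral_eq_of_identity h h12 hs, div_le_div_iff₀ (mul_pos h12pos (norm_pos_iff.mpr hs)) hσ]
  calc ‖Ginv‖ * ‖U‖ * σ ≤ γ * (‖twelve‖ * β) * ‖s‖ := by
        gcongr
    _ = γ * β * (‖twelve‖ * ‖s‖) := by ring

end Assembly

/-! ### §4. The denominator ledger's tight digit (lifting the exponent at `2`) -/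

section Ledger

/-- **`v₂(Σ_{x<2^m} u^x) = m` for `u ≡ 1 (mod 4)`, `u ≠ 1`**: the level-`m` sum of a truncated character `x ↦ u^x` over
one `ℤ₂`-direction has `2`-multiplicity EXACTLY `m = log₂ #cells` (LTE: `v₂(u^{2^m} − 1) = v₂(u − 1) + m` and
`u^{2^m} − 1 = (u − 1)·Σ_{x<2^m} u^x`), so the normalised Fourier coefficient `#cells⁻¹·Σ` is a `2`-adic unit. -/
theorem emultiplicity_two_geom_sum {u : ℤ} (hu4 : 4 ∣ u - 1) (hu1 : u ≠ 1) (m : ℕ) :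
    emultiplicity 2 (∑ i ∈ Finset.range (2 ^ m), u ^ i) = m := by
  have hu : ¬ 2 ∣ u := by
    intro h; obtain ⟨a, ha⟩ := hu4; obtain ⟨b, hb⟩ := h; omega
  have key := Int.two_pow_two_pow_sub_pow_two_pow (y := 1) m (by simpa using hu4) hu
  rw [one_pow, ← mul_geom_sum, emultiplicity_mul Int.prime_two] at key
  have hfin : emultiplicity 2 (u - 1) ≠ ⊤ :=
    finiteMultiplicity_iff_emultiplicity_ne_top.mp
      (Int.finiteMultiplicity_iff.mpr ⟨by norm_num, sub_ne_zero.mpr hu1⟩)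
  exact (WithTop.add_left_inj hfin).mp key

/-- **Two directions: `2`-multiplicity `2m = log₂ #cells` exactly** (the `ℤ₂²`-pair of the frame). -/
theorem emultiplicity_two_geom_sum_prod {u₁ u₂ : ℤ} (h₁ : 4 ∣ u₁ - 1) (h₁' : u₁ ≠ 1)
    (h₂ : 4 ∣ u₂ - 1) (h₂' : u₂ ≠ 1) (m : ℕ) :
    emultiplicity 2 ((∑ i ∈ Finset.range (2 ^ m), u₁ ^ i) * ∑ j ∈ Finset.range (2 ^ m), u₂ ^ j) =
      (2 * m : ℕ) := by
  rw [emultiplicity_mul Int.prime_two, emultiplicity_two_geom_sum h₁ h₁' m,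
    emultiplicity_two_geom_sum h₂ h₂' m]
  norm_cast; ring

end Ledger

end Summit.BirchSwinnertonDyer.Rank1Residual.P2.SmoothingDigit
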